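import Literature.Analysis.FunctionSpaces.LiebWuChargeGapStrongCouplingSeries
import Literature.Analysis.FunctionSpaces.LiebWuDoubleOccupancyEnclosure
import Literature.MathematicalPhysics.QuantumLattice.LiebWuBetheAnsatz
import HarnessLib

/-!
# Kernel-checked enclosures of the Lieb–Wu charge gap `μ₊ - μ₋` and of `μ₋` at `U = 3, 4, 5, 6, 8, 10, 12, 16`

Family `hubbard`; companion of `LiebWuChargeGapStrongCouplingSeries` (Takahashi's series (6.B.13) for
`I(U) = ∫₀^∞ J₁(ω) dω/(ω(1 + e^{ωU/2}))`, valid for `U > 2`, with the remainder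
`abs_integral_liebWuChargeGapIntegrand_sub_partialSum_le`) and of the energy / double-occupancy enclosure files (whose
`η(s)` enclosures `dirichletEta_*_bounds` and Mathlib's `log_two_near_10` are the only transcendental inputs). For each `U`
the file proves, by rational arithmetic (`norm_num` + `linarith`), two-sided bounds on the tree constants
`I(U)`, `liebWuChargeGap U = U - 4 + 8 I(U)` (Lieb–Wu (22): `μ₊ - μ₋`) and
`Literature.MathematicalPhysics.QuantumLattice.liebWuMuMinus U = 2 - 4 I(U)` (Lieb–Wu (23)); `U = 3, 4` lie inside this
series' disc `U > 2` although outside the energy series' `U > 4`.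

| `U` | terms `K` | `I(U)` | `μ₋(U)` | `μ₊ - μ₋` |
|---|---|---|---|---|
| 3 | 30 | [0.203924126, 0.203924204] | [1.184303184, 1.184303496] | [0.631393008, 0.631393632] |
| 4 | 15 | [0.160840869, 0.160840902] | [1.356636392, 1.356636524] | [1.286726952, 1.286727216] |
| 5 | 12 | [0.131982111, 0.131982128] | [1.472071488, 1.472071556] | [2.055856888, 2.055857024] |
| 6 | 10 | [0.111584301, 0.1115843103] | [1.5536627588, 1.553662796] | [2.892674408, 2.8926744824] |
| 8 | 7 | [0.0849396374, 0.0849396414] | [1.6602414344, 1.6602414504] | [4.6795170992, 4.6795171312] |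
| 10 | 6 | [0.0684321345, 0.0684321366] | [1.7262714536, 1.726271462] | [6.547457076, 6.5474570928] |
| 12 | 6 | [0.0572482162, 0.0572482175] | [1.77100713, 1.7710071352] | [8.4579857296, 8.45798574] |
| 16 | 5 | [0.0431034313, 0.0431034319] | [1.8275862724, 1.8275862748] | [12.3448274504, 12.3448274552] |

25-digit values of `I(U)` (this seat; Takahashi's series and the CVZ-accelerated alternating series (23) agree; the `I(3)` digits were corrected in a docstring-only revision after lit-3's cross-read — the first version printed a 30-term partial sum of the slow `U = 3` series, off by `2.1e-14`, inside the kernel row either way):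
`I(3) = 0.20392414724442964…`, `I(4) = 0.16084087775161304…`, `I(8) = 0.08493963843301012…`; `μ₊ - μ₋(U = 4) = 1.2867270220…`
(the value quoted in `LiebWuChemicalPotentialSeries`), `μ₊ - μ₋(U = 8) = 4.6795171074…`. Printed comparators are graphical
(Lieb–Wu 2003 Fig. 3; Essler et al. Fig. 6.6) or asymptotic ((6.B.12)–(6.B.13); Ovchinnikov's small-`U` law). No named
facts; HONEST FRAMING: statements about the Bethe-ansatz integrals (22)–(23); their identification with the chain's
charge gap is the named fact `lieb_wu`; not numbers of record of the programme.

## References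

* F. H. L. Essler et al., CUP 2005, eq. (6.B.13), PDF p. 213 (key `EsslerEtAl2005`).
* E. H. Lieb, F. Y. Wu, PRL 20 (1968) 1445, eqs. (22)–(23) (key `LiebWuPRL1968`).
-/

noncomputable section

open Real Finset Literature.MathematicalPhysics.QuantumLattice

namespace Literature.Analysis.FunctionSpaces

/-! ## The moments `α_1 … α_30` -/

/-- `α_1 = 1/8`. [cite: EsslerEtAl2005, eq. (6.B.13)] -/
theorem besselJOneMoment_1 : besselJOneMoment 1 = 1 / 8 := by
  norm_num [besselJOneMoment, Nat.choose_eq_factorial_div_factorial, Nat.factorial]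

/-- `α_2 = 1/16`. [cite: EsslerEtAl2005, eq. (6.B.13)] -/
theorem besselJOneMoment_2 : besselJOneMoment 2 = 1 / 16 := by
  norm_num [besselJOneMoment, Nat.choose_eq_factorial_div_factorial, Nat.factorial]

/-- `α_3 = 5/128`. [cite: EsslerEtAl2005, eq. (6.B.13)] -/
theorem besselJOneMoment_3 : besselJOneMoment 3 = 5 / 128 := by
  norm_num [besselJOneMoment, Nat.choose_eq_factorial_div_factorial, Nat.factorial]

/-- `α_4 = 7/256`. [cite: EsslerEtAl2005, eq. (6.B.13)] -/
theorem besselJOneMoment_4 : besselJOneMoment 4 = 7 / 256 := by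
  norm_num [besselJOneMoment, Nat.choose_eq_factorial_div_factorial, Nat.factorial]

/-- `α_5 = 21/1024`. [cite: EsslerEtAl2005, eq. (6.B.13)] -/
theorem besselJOneMoment_5 : besselJOneMoment 5 = 21 / 1024 := by
  norm_num [besselJOneMoment, Nat.choose_eq_factorial_div_factorial, Nat.factorial]

/-- `α_6 = 33/2048`. [cite: EsslerEtAl2005, eq. (6.B.13)] -/
theorem besselJOneMoment_6 : besselJOneMoment 6 = 33 / 2048 := by
  norm_num [besselJOneMoment, Nat.choose_eq_factorial_div_factorial, Nat.factorial]

/-- `α_7 = 429/32768`. [cite: EsslerEtAl2005, eq. (6.B.13)] -/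
theorem besselJOneMoment_7 : besselJOneMoment 7 = 429 / 32768 := by
  norm_num [besselJOneMoment, Nat.choose_eq_factorial_div_factorial, Nat.factorial]

/-- `α_8 = 715/65536`. [cite: EsslerEtAl2005, eq. (6.B.13)] -/
theorem besselJOneMoment_8 : besselJOneMoment 8 = 715 / 65536 := by
  norm_num [besselJOneMoment, Nat.choose_eq_factorial_div_factorial, Nat.factorial]

/-- `α_9 = 2431/262144`. [cite: EsslerEtAl2005, eq. (6.B.13)] -/
theorem besselJOneMoment_9 : besselJOneMoment 9 = 2431 / 262144 := by
  norm_num [besselJOneMoment, Nat.choose_eq_factorial_div_factorial, Nat.factorial]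

/-- `α_10 = 4199/524288`. [cite: EsslerEtAl2005, eq. (6.B.13)] -/
theorem besselJOneMoment_10 : besselJOneMoment 10 = 4199 / 524288 := by
  norm_num [besselJOneMoment, Nat.choose_eq_factorial_div_factorial, Nat.factorial]

/-- `α_11 = 29393/4194304`. [cite: EsslerEtAl2005, eq. (6.B.13)] -/
theorem besselJOneMoment_11 : besselJOneMoment 11 = 29393 / 4194304 := by
  norm_num [besselJOneMoment, Nat.choose_eq_factorial_div_factorial, Nat.factorial]

/-- `α_12 = 52003/8388608`. [cite: EsslerEtAl2005, eq. (6.B.13)] -/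
theorem besselJOneMoment_12 : besselJOneMoment 12 = 52003 / 8388608 := by
  norm_num [besselJOneMoment, Nat.choose_eq_factorial_div_factorial, Nat.factorial]

/-- `α_13 = 185725/33554432`. [cite: EsslerEtAl2005, eq. (6.B.13)] -/
theorem besselJOneMoment_13 : besselJOneMoment 13 = 185725 / 33554432 := by
  norm_num [besselJOneMoment, Nat.choose_eq_factorial_div_factorial, Nat.factorial]

/-- `α_14 = 334305/67108864`. [cite: EsslerEtAl2005, eq. (6.B.13)] -/
theorem besselJOneMoment_14 : besselJOneMoment 14 = 334305 / 67108864 := by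
  norm_num [besselJOneMoment, Nat.choose_eq_factorial_div_factorial, Nat.factorial]

/-- `α_15 = 9694845/2147483648`. [cite: EsslerEtAl2005, eq. (6.B.13)] -/
theorem besselJOneMoment_15 : besselJOneMoment 15 = 9694845 / 2147483648 := by
  norm_num [besselJOneMoment, Nat.choose_eq_factorial_div_factorial, Nat.factorial]

/-- `α_16 = 17678835/4294967296`. [cite: EsslerEtAl2005, eq. (6.B.13)] -/
theorem besselJOneMoment_16 : besselJOneMoment 16 = 17678835 / 4294967296 := by
  norm_num [besselJOneMoment, Nat.choose_eq_factorial_div_factorial, Nat.factorial]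

/-- `α_17 = 64822395/17179869184`. [cite: EsslerEtAl2005, eq. (6.B.13)] -/
theorem besselJOneMoment_17 : besselJOneMoment 17 = 64822395 / 17179869184 := by
  norm_num [besselJOneMoment, Nat.choose_eq_factorial_div_factorial, Nat.factorial]

/-- `α_18 = 119409675/34359738368`. [cite: EsslerEtAl2005, eq. (6.B.13)] -/
theorem besselJOneMoment_18 : besselJOneMoment 18 = 119409675 / 34359738368 := by
  norm_num [besselJOneMoment, Nat.choose_eq_factorial_div_factorial, Nat.factorial]

/-- `α_19 = 883631595/274877906944`. [cite: EsslerEtAl2005, eq. (6.B.13)] -/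
theorem besselJOneMoment_19 : besselJOneMoment 19 = 883631595 / 274877906944 := by
  norm_num [besselJOneMoment, Nat.choose_eq_factorial_div_factorial, Nat.factorial]

/-- `α_20 = 1641030105/549755813888`. [cite: EsslerEtAl2005, eq. (6.B.13)] -/
theorem besselJOneMoment_20 : besselJOneMoment 20 = 1641030105 / 549755813888 := by
  norm_num [besselJOneMoment, Nat.choose_eq_factorial_div_factorial, Nat.factorial]

/-- `α_21 = 6116566755/2199023255552`. [cite: EsslerEtAl2005, eq. (6.B.13)] -/
theorem besselJOneMoment_21 : besselJOneMoment 21 = 6116566755 / 2199023255552 := by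
  norm_num [besselJOneMoment, Nat.choose_eq_factorial_div_factorial, Nat.factorial]

/-- `α_22 = 11435320455/4398046511104`. [cite: EsslerEtAl2005, eq. (6.B.13)] -/
theorem besselJOneMoment_22 : besselJOneMoment 22 = 11435320455 / 4398046511104 := by
  norm_num [besselJOneMoment, Nat.choose_eq_factorial_div_factorial, Nat.factorial]

/-- `α_23 = 171529806825/70368744177664`. [cite: EsslerEtAl2005, eq. (6.B.13)] -/
theorem besselJOneMoment_23 : besselJOneMoment 23 = 171529806825 / 70368744177664 := by
  norm_num [besselJOneMoment, Nat.choose_eq_factorial_div_factorial, Nat.factorial]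

/-- `α_24 = 322476036831/140737488355328`. [cite: EsslerEtAl2005, eq. (6.B.13)] -/
theorem besselJOneMoment_24 : besselJOneMoment 24 = 322476036831 / 140737488355328 := by
  norm_num [besselJOneMoment, Nat.choose_eq_factorial_div_factorial, Nat.factorial]

/-- `α_25 = 1215486600363/562949953421312`. [cite: EsslerEtAl2005, eq. (6.B.13)] -/
theorem besselJOneMoment_25 : besselJOneMoment 25 = 1215486600363 / 562949953421312 := by
  norm_num [besselJOneMoment, Nat.choose_eq_factorial_div_factorial, Nat.factorial]

/-- `α_26 = 2295919134019/1125899906842624`. [cite: EsslerEtAl2005, eq. (6.B.13)] -/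
theorem besselJOneMoment_26 : besselJOneMoment 26 = 2295919134019 / 1125899906842624 := by
  norm_num [besselJOneMoment, Nat.choose_eq_factorial_div_factorial, Nat.factorial]

/-- `α_27 = 17383387729001/9007199254740992`. [cite: EsslerEtAl2005, eq. (6.B.13)] -/
theorem besselJOneMoment_27 : besselJOneMoment 27 = 17383387729001 / 9007199254740992 := by
  norm_num [besselJOneMoment, Nat.choose_eq_factorial_div_factorial, Nat.factorial]

/-- `α_28 = 32968493968795/18014398509481984`. [cite: EsslerEtAl2005, eq. (6.B.13)] -/
theorem besselJOneMoment_28 : besselJOneMoment 28 = 32968493968795 / 18014398509481984 := by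
  norm_num [besselJOneMoment, Nat.choose_eq_factorial_div_factorial, Nat.factorial]

/-- `α_29 = 125280277081421/72057594037927936`. [cite: EsslerEtAl2005, eq. (6.B.13)] -/
theorem besselJOneMoment_29 : besselJOneMoment 29 = 125280277081421 / 72057594037927936 := by
  norm_num [besselJOneMoment, Nat.choose_eq_factorial_div_factorial, Nat.factorial]

/-- `α_30 = 238436656380769/144115188075855872`. [cite: EsslerEtAl2005, eq. (6.B.13)] -/
theorem besselJOneMoment_30 : besselJOneMoment 30 = 238436656380769 / 144115188075855872 := by
  norm_num [besselJOneMoment, Nat.choose_eq_factorial_div_factorial, Nat.factorial]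

/-! ## The enclosures -/

/-- **`∫₀^∞ J₁/(ω(1 + e^{3ω/2})) ∈ [0.203924126, 0.203924204]`** (`K = 30` terms; 25-digit value `0.203924147244429646…`).
[cite: EsslerEtAl2005, eq. (6.B.13)] -/
theorem integral_liebWuChargeGapIntegrand_three_mem_Icc :
    (∫ ω in Set.Ioi (0 : ℝ), liebWuChargeGapIntegrand 3 ω) ∈ Set.Icc (0.203924126 : ℝ) 0.203924204 := by
  have h := abs_integral_liebWuChargeGapIntegrand_sub_partialSum_le (U := 3) (by norm_num) 30
  rw [abs_le] at h
  norm_num [Finset.sum_range_succ, liebWuMuStrongCouplingTerm, besselJOneMoment_1, besselJOneMoment_2, besselJOneMoment_3, besselJOneMoment_4, besselJOneMoment_5, besselJOneMoment_6, besselJOneMoment_7, besselJOneMoment_8, besselJOneMoment_9, besselJOneMoment_10, besselJOneMoment_11, besselJOneMoment_12, besselJOneMoment_13, besselJOneMoment_14, besselJOneMoment_15, besselJOneMoment_16, besselJOneMoment_17, besselJOneMoment_18, besselJOneMoment_19, besselJOneMoment_20, besselJOneMoment_21, besselJOneMoment_22, besselJOneMoment_23, besselJOneMoment_24, besselJOneMoment_25,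 besselJOneMoment_26, besselJOneMoment_27, besselJOneMoment_28, besselJOneMoment_29, besselJOneMoment_30] at h
  obtain ⟨a0, b0⟩ := dirichletEta_3_bounds
  obtain ⟨a1, b1⟩ := dirichletEta_5_bounds
  obtain ⟨a2, b2⟩ := dirichletEta_7_bounds
  obtain ⟨a3, b3⟩ := dirichletEta_9_bounds
  obtain ⟨a4, b4⟩ := dirichletEta_11_bounds
  obtain ⟨a5, b5⟩ := dirichletEta_13_bounds
  obtain ⟨a6, b6⟩ := dirichletEta_15_bounds
  obtain ⟨a7, b7⟩ := dirichletEta_17_bounds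
  obtain ⟨a8, b8⟩ := dirichletEta_19_bounds
  obtain ⟨a9, b9⟩ := dirichletEta_21_bounds
  obtain ⟨a10, b10⟩ := dirichletEta_23_bounds
  obtain ⟨a11, b11⟩ := dirichletEta_25_bounds
  obtain ⟨a12, b12⟩ := dirichletEta_27_bounds
  obtain ⟨a13, b13⟩ := dirichletEta_29_bounds
  obtain ⟨a14, b14⟩ := dirichletEta_31_bounds
  obtain ⟨a15, b15⟩ := dirichletEta_33_bounds
  obtain ⟨a16, b16⟩ := dirichletEta_35_bounds
  obtain ⟨a17, b17⟩ := dirichletEta_37_bounds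
  obtain ⟨a18, b18⟩ := dirichletEta_39_bounds
  obtain ⟨a19, b19⟩ := dirichletEta_41_bounds
  obtain ⟨a20, b20⟩ := dirichletEta_43_bounds
  obtain ⟨a21, b21⟩ := dirichletEta_45_bounds
  obtain ⟨a22, b22⟩ := dirichletEta_47_bounds
  obtain ⟨a23, b23⟩ := dirichletEta_49_bounds
  obtain ⟨a24, b24⟩ := dirichletEta_51_bounds
  obtain ⟨a25, b25⟩ := dirichletEta_53_bounds
  obtain ⟨a26, b26⟩ := dirichletEta_55_bounds
  obtain ⟨a27, b27⟩ := dirichletEta_57_bounds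
  obtain ⟨a28, b28⟩ := dirichletEta_59_bounds
  obtain ⟨a29, b29⟩ := dirichletEta_61_bounds
  have l := Real.log_two_near_10
  rw [abs_le] at l
  norm_num at l
  rw [Set.mem_Icc]
  constructor
  · linarith [h.1]
  · linarith [h.2]

/-- **The Lieb–Wu charge gap `μ₊ - μ₋` at `U = 3`: `liebWuChargeGap 3 ∈ [0.631393008, 0.631393632]`.**
[cite: LiebWuPRL1968, eq. (22)] -/
theorem liebWuChargeGap_three_mem_Icc : liebWuChargeGap 3 ∈ Set.Icc (0.631393008 : ℝ) 0.631393632 := by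
  have h := integral_liebWuChargeGapIntegrand_three_mem_Icc
  rw [Set.mem_Icc] at h ⊢
  rw [liebWuChargeGap]
  constructor <;> linarith [h.1, h.2]

/-- **Lieb–Wu's `μ₋` at `U = 3`: `liebWuMuMinus 3 ∈ [1.184303184, 1.184303496]`** (Essler's `μ₋(u = 0.75) = liebWuMuMinus 3 - 1.5`).
[cite: LiebWuPRL1968, eq. (23)] -/
theorem liebWuMuMinus_three_mem_Icc : liebWuMuMinus 3 ∈ Set.Icc (1.184303184 : ℝ) 1.184303496 := by
  have h := integral_liebWuChargeGapIntegrand_three_mem_Icc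
  rw [Set.mem_Icc] at h ⊢
  rw [liebWuMuMinus]
  constructor <;> linarith [h.1, h.2]

/-- **`∫₀^∞ J₁/(ω(1 + e^{4ω/2})) ∈ [0.160840869, 0.160840902]`** (`K = 15` terms; 25-digit value `0.160840877751613049…`).
[cite: EsslerEtAl2005, eq. (6.B.13)] -/
theorem integral_liebWuChargeGapIntegrand_four_mem_Icc :
    (∫ ω in Set.Ioi (0 : ℝ), liebWuChargeGapIntegrand 4 ω) ∈ Set.Icc (0.160840869 : ℝ) 0.160840902 := by
  have h := abs_integral_liebWuChargeGapIntegrand_sub_partialSum_le (U := 4) (by norm_num) 15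
  rw [abs_le] at h
  norm_num [Finset.sum_range_succ, liebWuMuStrongCouplingTerm, besselJOneMoment_1, besselJOneMoment_2, besselJOneMoment_3, besselJOneMoment_4, besselJOneMoment_5, besselJOneMoment_6, besselJOneMoment_7, besselJOneMoment_8, besselJOneMoment_9, besselJOneMoment_10, besselJOneMoment_11, besselJOneMoment_12, besselJOneMoment_13, besselJOneMoment_14, besselJOneMoment_15] at h
  obtain ⟨a0, b0⟩ := dirichletEta_3_bounds
  obtain ⟨a1, b1⟩ := dirichletEta_5_bounds
  obtain ⟨a2, b2⟩ := dirichletEta_7_bounds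
  obtain ⟨a3, b3⟩ := dirichletEta_9_bounds
  obtain ⟨a4, b4⟩ := dirichletEta_11_bounds
  obtain ⟨a5, b5⟩ := dirichletEta_13_bounds
  obtain ⟨a6, b6⟩ := dirichletEta_15_bounds
  obtain ⟨a7, b7⟩ := dirichletEta_17_bounds
  obtain ⟨a8, b8⟩ := dirichletEta_19_bounds
  obtain ⟨a9, b9⟩ := dirichletEta_21_bounds
  obtain ⟨a10, b10⟩ := dirichletEta_23_bounds
  obtain ⟨a11, b11⟩ := dirichletEta_25_bounds
  obtain ⟨a12, b12⟩ := dirichletEta_27_bounds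
  obtain ⟨a13, b13⟩ := dirichletEta_29_bounds
  obtain ⟨a14, b14⟩ := dirichletEta_31_bounds
  have l := Real.log_two_near_10
  rw [abs_le] at l
  norm_num at l
  rw [Set.mem_Icc]
  constructor
  · linarith [h.1]
  · linarith [h.2]

/-- **The Lieb–Wu charge gap `μ₊ - μ₋` at `U = 4`: `liebWuChargeGap 4 ∈ [1.286726952, 1.286727216]`.**
[cite: LiebWuPRL1968, eq. (22)] -/
theorem liebWuChargeGap_four_mem_Icc : liebWuChargeGap 4 ∈ Set.Icc (1.286726952 : ℝ) 1.286727216 := by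
  have h := integral_liebWuChargeGapIntegrand_four_mem_Icc
  rw [Set.mem_Icc] at h ⊢
  rw [liebWuChargeGap]
  constructor <;> linarith [h.1, h.2]

/-- **Lieb–Wu's `μ₋` at `U = 4`: `liebWuMuMinus 4 ∈ [1.356636392, 1.356636524]`** (Essler's `μ₋(u = 1) = liebWuMuMinus 4 - 2`).
[cite: LiebWuPRL1968, eq. (23)] -/
theorem liebWuMuMinus_four_mem_Icc : liebWuMuMinus 4 ∈ Set.Icc (1.356636392 : ℝ) 1.356636524 := by
  have h := integral_liebWuChargeGapIntegrand_four_mem_Icc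
  rw [Set.mem_Icc] at h ⊢
  rw [liebWuMuMinus]
  constructor <;> linarith [h.1, h.2]

/-- **`∫₀^∞ J₁/(ω(1 + e^{5ω/2})) ∈ [0.131982111, 0.131982128]`** (`K = 12` terms; 25-digit value `0.131982115651433611…`).
[cite: EsslerEtAl2005, eq. (6.B.13)] -/
theorem integral_liebWuChargeGapIntegrand_five_mem_Icc :
    (∫ ω in Set.Ioi (0 : ℝ), liebWuChargeGapIntegrand 5 ω) ∈ Set.Icc (0.131982111 : ℝ) 0.131982128 := by
  have h := abs_integral_liebWuChargeGapIntegrand_sub_partialSum_le (U := 5) (by norm_num) 12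
  rw [abs_le] at h
  norm_num [Finset.sum_range_succ, liebWuMuStrongCouplingTerm, besselJOneMoment_1, besselJOneMoment_2, besselJOneMoment_3, besselJOneMoment_4, besselJOneMoment_5, besselJOneMoment_6, besselJOneMoment_7, besselJOneMoment_8, besselJOneMoment_9, besselJOneMoment_10, besselJOneMoment_11, besselJOneMoment_12] at h
  obtain ⟨a0, b0⟩ := dirichletEta_3_bounds
  obtain ⟨a1, b1⟩ := dirichletEta_5_bounds
  obtain ⟨a2, b2⟩ := dirichletEta_7_bounds
  obtain ⟨a3, b3⟩ := dirichletEta_9_bounds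
  obtain ⟨a4, b4⟩ := dirichletEta_11_bounds
  obtain ⟨a5, b5⟩ := dirichletEta_13_bounds
  obtain ⟨a6, b6⟩ := dirichletEta_15_bounds
  obtain ⟨a7, b7⟩ := dirichletEta_17_bounds
  obtain ⟨a8, b8⟩ := dirichletEta_19_bounds
  obtain ⟨a9, b9⟩ := dirichletEta_21_bounds
  obtain ⟨a10, b10⟩ := dirichletEta_23_bounds
  obtain ⟨a11, b11⟩ := dirichletEta_25_bounds
  have l := Real.log_two_near_10
  rw [abs_le] at l
  norm_num at l
  rw [Set.mem_Icc]
  constructor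
  · linarith [h.1]
  · linarith [h.2]

/-- **The Lieb–Wu charge gap `μ₊ - μ₋` at `U = 5`: `liebWuChargeGap 5 ∈ [2.055856888, 2.055857024]`.**
[cite: LiebWuPRL1968, eq. (22)] -/
theorem liebWuChargeGap_five_mem_Icc : liebWuChargeGap 5 ∈ Set.Icc (2.055856888 : ℝ) 2.055857024 := by
  have h := integral_liebWuChargeGapIntegrand_five_mem_Icc
  rw [Set.mem_Icc] at h ⊢
  rw [liebWuChargeGap]
  constructor <;> linarith [h.1, h.2]

/-- **Lieb–Wu's `μ₋` at `U = 5`: `liebWuMuMinus 5 ∈ [1.472071488, 1.472071556]`** (Essler's `μ₋(u = 1.25) = liebWuMuMinus 5 - 2.5`).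
[cite: LiebWuPRL1968, eq. (23)] -/
theorem liebWuMuMinus_five_mem_Icc : liebWuMuMinus 5 ∈ Set.Icc (1.472071488 : ℝ) 1.472071556 := by
  have h := integral_liebWuChargeGapIntegrand_five_mem_Icc
  rw [Set.mem_Icc] at h ⊢
  rw [liebWuMuMinus]
  constructor <;> linarith [h.1, h.2]

/-- **`∫₀^∞ J₁/(ω(1 + e^{6ω/2})) ∈ [0.111584301, 0.1115843103]`** (`K = 10` terms; 25-digit value `0.111584303382942067…`).
[cite: EsslerEtAl2005, eq. (6.B.13)] -/
theorem integral_liebWuChargeGapIntegrand_six_mem_Icc :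
    (∫ ω in Set.Ioi (0 : ℝ), liebWuChargeGapIntegrand 6 ω) ∈ Set.Icc (0.111584301 : ℝ) 0.1115843103 := by
  have h := abs_integral_liebWuChargeGapIntegrand_sub_partialSum_le (U := 6) (by norm_num) 10
  rw [abs_le] at h
  norm_num [Finset.sum_range_succ, liebWuMuStrongCouplingTerm, besselJOneMoment_1, besselJOneMoment_2, besselJOneMoment_3, besselJOneMoment_4, besselJOneMoment_5, besselJOneMoment_6, besselJOneMoment_7, besselJOneMoment_8, besselJOneMoment_9, besselJOneMoment_10] at h
  obtain ⟨a0, b0⟩ := dirichletEta_3_bounds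
  obtain ⟨a1, b1⟩ := dirichletEta_5_bounds
  obtain ⟨a2, b2⟩ := dirichletEta_7_bounds
  obtain ⟨a3, b3⟩ := dirichletEta_9_bounds
  obtain ⟨a4, b4⟩ := dirichletEta_11_bounds
  obtain ⟨a5, b5⟩ := dirichletEta_13_bounds
  obtain ⟨a6, b6⟩ := dirichletEta_15_bounds
  obtain ⟨a7, b7⟩ := dirichletEta_17_bounds
  obtain ⟨a8, b8⟩ := dirichletEta_19_bounds
  obtain ⟨a9, b9⟩ := dirichletEta_21_bounds
  have l := Real.log_two_near_10
  rw [abs_le] at l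
  norm_num at l
  rw [Set.mem_Icc]
  constructor
  · linarith [h.1]
  · linarith [h.2]

/-- **The Lieb–Wu charge gap `μ₊ - μ₋` at `U = 6`: `liebWuChargeGap 6 ∈ [2.892674408, 2.8926744824]`.**
[cite: LiebWuPRL1968, eq. (22)] -/
theorem liebWuChargeGap_six_mem_Icc : liebWuChargeGap 6 ∈ Set.Icc (2.892674408 : ℝ) 2.8926744824 := by
  have h := integral_liebWuChargeGapIntegrand_six_mem_Icc
  rw [Set.mem_Icc] at h ⊢
  rw [liebWuChargeGap]
  constructor <;> linarith [h.1, h.2]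

/-- **Lieb–Wu's `μ₋` at `U = 6`: `liebWuMuMinus 6 ∈ [1.5536627588, 1.553662796]`** (Essler's `μ₋(u = 1.5) = liebWuMuMinus 6 - 3`).
[cite: LiebWuPRL1968, eq. (23)] -/
theorem liebWuMuMinus_six_mem_Icc : liebWuMuMinus 6 ∈ Set.Icc (1.5536627588 : ℝ) 1.553662796 := by
  have h := integral_liebWuChargeGapIntegrand_six_mem_Icc
  rw [Set.mem_Icc] at h ⊢
  rw [liebWuMuMinus]
  constructor <;> linarith [h.1, h.2]

/-- **`∫₀^∞ J₁/(ω(1 + e^{8ω/2})) ∈ [0.0849396374, 0.0849396414]`** (`K = 7` terms; 25-digit value `0.084939638433010120…`).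
[cite: EsslerEtAl2005, eq. (6.B.13)] -/
theorem integral_liebWuChargeGapIntegrand_eight_mem_Icc :
    (∫ ω in Set.Ioi (0 : ℝ), liebWuChargeGapIntegrand 8 ω) ∈ Set.Icc (0.0849396374 : ℝ) 0.0849396414 := by
  have h := abs_integral_liebWuChargeGapIntegrand_sub_partialSum_le (U := 8) (by norm_num) 7
  rw [abs_le] at h
  norm_num [Finset.sum_range_succ, liebWuMuStrongCouplingTerm, besselJOneMoment_1, besselJOneMoment_2, besselJOneMoment_3, besselJOneMoment_4, besselJOneMoment_5, besselJOneMoment_6, besselJOneMoment_7] at h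
  obtain ⟨a0, b0⟩ := dirichletEta_3_bounds
  obtain ⟨a1, b1⟩ := dirichletEta_5_bounds
  obtain ⟨a2, b2⟩ := dirichletEta_7_bounds
  obtain ⟨a3, b3⟩ := dirichletEta_9_bounds
  obtain ⟨a4, b4⟩ := dirichletEta_11_bounds
  obtain ⟨a5, b5⟩ := dirichletEta_13_bounds
  obtain ⟨a6, b6⟩ := dirichletEta_15_bounds
  have l := Real.log_two_near_10
  rw [abs_le] at l
  norm_num at l
  rw [Set.mem_Icc]
  constructor
  · linarith [h.1]
  · linarith [h.2]

/-- **The Lieb–Wu charge gap `μ₊ - μ₋` at `U = 8`: `liebWuChargeGap 8 ∈ [4.6795170992, 4.6795171312]`.**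
[cite: LiebWuPRL1968, eq. (22)] -/
theorem liebWuChargeGap_eight_mem_Icc : liebWuChargeGap 8 ∈ Set.Icc (4.6795170992 : ℝ) 4.6795171312 := by
  have h := integral_liebWuChargeGapIntegrand_eight_mem_Icc
  rw [Set.mem_Icc] at h ⊢
  rw [liebWuChargeGap]
  constructor <;> linarith [h.1, h.2]

/-- **Lieb–Wu's `μ₋` at `U = 8`: `liebWuMuMinus 8 ∈ [1.6602414344, 1.6602414504]`** (Essler's `μ₋(u = 2) = liebWuMuMinus 8 - 4`).
[cite: LiebWuPRL1968, eq. (23)] -/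
theorem liebWuMuMinus_eight_mem_Icc : liebWuMuMinus 8 ∈ Set.Icc (1.6602414344 : ℝ) 1.6602414504 := by
  have h := integral_liebWuChargeGapIntegrand_eight_mem_Icc
  rw [Set.mem_Icc] at h ⊢
  rw [liebWuMuMinus]
  constructor <;> linarith [h.1, h.2]

/-- **`∫₀^∞ J₁/(ω(1 + e^{10ω/2})) ∈ [0.0684321345, 0.0684321366]`** (`K = 6` terms; 25-digit value `0.068432135043430017…`).
[cite: EsslerEtAl2005, eq. (6.B.13)] -/
theorem integral_liebWuChargeGapIntegrand_ten_mem_Icc :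
    (∫ ω in Set.Ioi (0 : ℝ), liebWuChargeGapIntegrand 10 ω) ∈ Set.Icc (0.0684321345 : ℝ) 0.0684321366 := by
  have h := abs_integral_liebWuChargeGapIntegrand_sub_partialSum_le (U := 10) (by norm_num) 6
  rw [abs_le] at h
  norm_num [Finset.sum_range_succ, liebWuMuStrongCouplingTerm, besselJOneMoment_1, besselJOneMoment_2, besselJOneMoment_3, besselJOneMoment_4, besselJOneMoment_5, besselJOneMoment_6] at h
  obtain ⟨a0, b0⟩ := dirichletEta_3_bounds
  obtain ⟨a1, b1⟩ := dirichletEta_5_bounds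
  obtain ⟨a2, b2⟩ := dirichletEta_7_bounds
  obtain ⟨a3, b3⟩ := dirichletEta_9_bounds
  obtain ⟨a4, b4⟩ := dirichletEta_11_bounds
  obtain ⟨a5, b5⟩ := dirichletEta_13_bounds
  have l := Real.log_two_near_10
  rw [abs_le] at l
  norm_num at l
  rw [Set.mem_Icc]
  constructor
  · linarith [h.1]
  · linarith [h.2]

/-- **The Lieb–Wu charge gap `μ₊ - μ₋` at `U = 10`: `liebWuChargeGap 10 ∈ [6.547457076, 6.5474570928]`.**
[cite: LiebWuPRL1968, eq. (22)] -/
theorem liebWuChargeGap_ten_mem_Icc : liebWuChargeGap 10 ∈ Set.Icc (6.547457076 : ℝ) 6.5474570928 := by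
  have h := integral_liebWuChargeGapIntegrand_ten_mem_Icc
  rw [Set.mem_Icc] at h ⊢
  rw [liebWuChargeGap]
  constructor <;> linarith [h.1, h.2]

/-- **Lieb–Wu's `μ₋` at `U = 10`: `liebWuMuMinus 10 ∈ [1.7262714536, 1.726271462]`** (Essler's `μ₋(u = 2.5) = liebWuMuMinus 10 - 5`).
[cite: LiebWuPRL1968, eq. (23)] -/
theorem liebWuMuMinus_ten_mem_Icc : liebWuMuMinus 10 ∈ Set.Icc (1.7262714536 : ℝ) 1.726271462 := by
  have h := integral_liebWuChargeGapIntegrand_ten_mem_Icc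
  rw [Set.mem_Icc] at h ⊢
  rw [liebWuMuMinus]
  constructor <;> linarith [h.1, h.2]

/-- **`∫₀^∞ J₁/(ω(1 + e^{12ω/2})) ∈ [0.0572482162, 0.0572482175]`** (`K = 6` terms; 25-digit value `0.057248216568353053…`).
[cite: EsslerEtAl2005, eq. (6.B.13)] -/
theorem integral_liebWuChargeGapIntegrand_twelve_mem_Icc :
    (∫ ω in Set.Ioi (0 : ℝ), liebWuChargeGapIntegrand 12 ω) ∈ Set.Icc (0.0572482162 : ℝ) 0.0572482175 := by
  have h := abs_integral_liebWuChargeGapIntegrand_sub_partialSum_le (U := 12) (by norm_num) 6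
  rw [abs_le] at h
  norm_num [Finset.sum_range_succ, liebWuMuStrongCouplingTerm, besselJOneMoment_1, besselJOneMoment_2, besselJOneMoment_3, besselJOneMoment_4, besselJOneMoment_5, besselJOneMoment_6] at h
  obtain ⟨a0, b0⟩ := dirichletEta_3_bounds
  obtain ⟨a1, b1⟩ := dirichletEta_5_bounds
  obtain ⟨a2, b2⟩ := dirichletEta_7_bounds
  obtain ⟨a3, b3⟩ := dirichletEta_9_bounds
  obtain ⟨a4, b4⟩ := dirichletEta_11_bounds
  obtain ⟨a5, b5⟩ := dirichletEta_13_bounds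
  have l := Real.log_two_near_10
  rw [abs_le] at l
  norm_num at l
  rw [Set.mem_Icc]
  constructor
  · linarith [h.1]
  · linarith [h.2]

/-- **The Lieb–Wu charge gap `μ₊ - μ₋` at `U = 12`: `liebWuChargeGap 12 ∈ [8.4579857296, 8.45798574]`.**
[cite: LiebWuPRL1968, eq. (22)] -/
theorem liebWuChargeGap_twelve_mem_Icc : liebWuChargeGap 12 ∈ Set.Icc (8.4579857296 : ℝ) 8.45798574 := by
  have h := integral_liebWuChargeGapIntegrand_twelve_mem_Icc
  rw [Set.mem_Icc] at h ⊢
  rw [liebWuChargeGap]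
  constructor <;> linarith [h.1, h.2]

/-- **Lieb–Wu's `μ₋` at `U = 12`: `liebWuMuMinus 12 ∈ [1.77100713, 1.7710071352]`** (Essler's `μ₋(u = 3) = liebWuMuMinus 12 - 6`).
[cite: LiebWuPRL1968, eq. (23)] -/
theorem liebWuMuMinus_twelve_mem_Icc : liebWuMuMinus 12 ∈ Set.Icc (1.77100713 : ℝ) 1.7710071352 := by
  have h := integral_liebWuChargeGapIntegrand_twelve_mem_Icc
  rw [Set.mem_Icc] at h ⊢
  rw [liebWuMuMinus]
  constructor <;> linarith [h.1, h.2]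

/-- **`∫₀^∞ J₁/(ω(1 + e^{16ω/2})) ∈ [0.0431034313, 0.0431034319]`** (`K = 5` terms; 25-digit value `0.043103431476075063…`).
[cite: EsslerEtAl2005, eq. (6.B.13)] -/
theorem integral_liebWuChargeGapIntegrand_sixteen_mem_Icc :
    (∫ ω in Set.Ioi (0 : ℝ), liebWuChargeGapIntegrand 16 ω) ∈ Set.Icc (0.0431034313 : ℝ) 0.0431034319 := by
  have h := abs_integral_liebWuChargeGapIntegrand_sub_partialSum_le (U := 16) (by norm_num) 5
  rw [abs_le] at h
  norm_num [Finset.sum_range_succ, liebWuMuStrongCouplingTerm, besselJOneMoment_1, besselJOneMoment_2, besselJOneMoment_3, besselJOneMoment_4, besselJOneMoment_5] at h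
  obtain ⟨a0, b0⟩ := dirichletEta_3_bounds
  obtain ⟨a1, b1⟩ := dirichletEta_5_bounds
  obtain ⟨a2, b2⟩ := dirichletEta_7_bounds
  obtain ⟨a3, b3⟩ := dirichletEta_9_bounds
  obtain ⟨a4, b4⟩ := dirichletEta_11_bounds
  have l := Real.log_two_near_10
  rw [abs_le] at l
  norm_num at l
  rw [Set.mem_Icc]
  constructor
  · linarith [h.1]
  · linarith [h.2]

/-- **The Lieb–Wu charge gap `μ₊ - μ₋` at `U = 16`: `liebWuChargeGap 16 ∈ [12.3448274504, 12.3448274552]`.**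
[cite: LiebWuPRL1968, eq. (22)] -/
theorem liebWuChargeGap_sixteen_mem_Icc : liebWuChargeGap 16 ∈ Set.Icc (12.3448274504 : ℝ) 12.3448274552 := by
  have h := integral_liebWuChargeGapIntegrand_sixteen_mem_Icc
  rw [Set.mem_Icc] at h ⊢
  rw [liebWuChargeGap]
  constructor <;> linarith [h.1, h.2]

/-- **Lieb–Wu's `μ₋` at `U = 16`: `liebWuMuMinus 16 ∈ [1.8275862724, 1.8275862748]`** (Essler's `μ₋(u = 4) = liebWuMuMinus 16 - 8`).
[cite: LiebWuPRL1968, eq. (23)] -/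
theorem liebWuMuMinus_sixteen_mem_Icc : liebWuMuMinus 16 ∈ Set.Icc (1.8275862724 : ℝ) 1.8275862748 := by
  have h := integral_liebWuChargeGapIntegrand_sixteen_mem_Icc
  rw [Set.mem_Icc] at h ⊢
  rw [liebWuMuMinus]
  constructor <;> linarith [h.1, h.2]

end Literature.Analysis.FunctionSpaces
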